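import Literature.MathematicalPhysics.QuantumLattice.TorusCooperSumFermiLevel
import Literature.MathematicalPhysics.QuantumLattice.TorusCooperSumRowWalk
import HarnessLib

/-!
# The Cooper logarithm on the torus: `torusCooperSum L N (1/L) ≥ c log L`

Topic `MathematicalPhysics/QuantumLattice`. The elementary lower bound requested with the
definition of the torus Cooper sum (`TorusCooperSum.lean`; route `TorusCooperLog` of summit
`HubbardSuperconductivity`): for fillings bounded away from the empty and the full band the
zero-temperature particle–particle bubble of the free `L × L` torus, regularised by the buffer
`η = 1/L`, grows at least like `log L` — the finite-volume twin of the `½N(0) log β` divergence of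
Salmhofer's bubble (barrier `Literature.Barriers.HubbardSuperconductivity.WeakCouplingCeiling`).
Everything is PROVED; only the LOWER bound is asserted (the matching upper bound and the
asymptotics `≈ 2ρ̄ log L` are research statements of the route and are not here).

* `sub_one_le_card_filter_mem_Icc` — discrete intermediate-value count: a sequence with steps
  `≤ h` from above `a + ℓ` to below `a` visits `[a, a + ℓ]` at least `ℓ/h - 1` times;
* `card_cooperGoodRows_ge` — for `|μ_L| ≤ 4 - s²` at least `s²L/(32π)` rows `k₂` of the grid
  cross the Fermi level transversally (`|2cos(2πk₂/L) + μ_L| ≤ 2 - s²/2`);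
* `torusXi_vecCons`, `sum_torusSite_two_eq`, `torusRow_sum_ge` — dictionary between the torus
  objects and the row walk of `TorusCooperSumRowWalk.lean`;
* `torusCooperSum_inv_ge` — **quantitative form**: `θL² ≤ N ≤ (2 - θ)L²`, `L ≥ 6400/θ²`,
  `L ≥ (8192/θ³)²` imply `torusCooperSum L N (1/L) ≥ θ²/(16384π²) · log L`;
* `exists_log_le_torusCooperSum` — `∃ c > 0, ∃ L₀, ∀ L ≥ L₀, ∀ N ∈ [θL², (2-θ)L²], ∀ η ≤ 1/L,
  c log L ≤ ℓ_L(η)` (buffers `η ≤ 1/L`, e.g. `η = 0`, by antitonicity);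
* `exists_log_le_torusCooperSum_doping` — the same at hole doping `δ ∈ [0, 1)`,
  `N_L = 2⌊(1 - δ)L²/2⌋` (the canonical sector of the summit).

Proof (the "bulk rows" argument): the shell level stays in `[-4 + θ²/16, 4 - θ²/16]`
(`torusFermiLevel_mem_Icc`); a row crossing it transversally contributes `(L/(32π)) log L`
(`cooperRow_sum_ge`: to the right of the crossing the energies `ξ` climb in steps between `s/L`
and `4π/L`, so `Σ 1/(2|ξ|)` is a harmonic sum); there are `≳ θ²L/(512π)` such rows. Constants are
not optimised.

## References

* M. Salmhofer, *Renormalization: An Introduction*, Springer 1999, §4.5.4, eqs. (4.200)–(4.203)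
  (`B⁻(0) = ½N(0) log(βε₀/2) + O(1)`). [Salmhofer1999]
* K. A. Matveev, A. I. Larkin, Phys. Rev. Lett. 78 (1997) 3749 (level spacing as the infrared
  cutoff of the pairing logarithm in ultrasmall grains). [MatveevLarkin1997]
-/

noncomputable section

open Finset
open Literature.Probability.LatticeModels

namespace Literature.MathematicalPhysics.QuantumLattice

/-! ### Good rows -/

section GoodRows

open Real

/-- **Discrete intermediate-value count.** A real sequence with steps at most `h` that starts
at or above `a + ℓ` (at `n = 0`) and ends below `a` (at `n = m`) visits `[a, a + ℓ]` at least
`ℓ/h - 1` times in between. [folklore] -/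
theorem sub_one_le_card_filter_mem_Icc {x : ℕ → ℝ} {m : ℕ} {h a ℓ : ℝ} (hh : 0 < h) (hℓ : 0 ≤ ℓ)
    (hstep : ∀ n < m, |x (n + 1) - x n| ≤ h) (hma : x m < a) (h0 : a + ℓ ≤ x 0) :
    ℓ / h - 1 ≤ (((Finset.range (m + 1)).filter fun n => a ≤ x n ∧ x n ≤ a + ℓ).card : ℝ) := by
  classical
  have hex : ∃ n, x n < a := ⟨m, hma⟩
  have hna_spec : x (Nat.find hex) < a := Nat.find_spec hex
  have hna_le : Nat.find hex ≤ m := Nat.find_min' hex hma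
  have hna_min : ∀ n < Nat.find hex, a ≤ x n := fun n hn => not_lt.mp (Nat.find_min hex hn)
  have hna_pos : 0 < Nat.find hex := by
    rw [Nat.pos_iff_ne_zero]
    intro h0'
    rw [h0'] at hna_spec
    linarith
  set na := Nat.find hex with hna
  set nb := Nat.findGreatest (fun n => a + ℓ ≤ x n) (na - 1) with hnb
  have hnb_le : nb ≤ na - 1 := Nat.findGreatest_le _
  have hnb_spec : a + ℓ ≤ x nb :=
    Nat.findGreatest_spec (P := fun n => a + ℓ ≤ x n) (Nat.zero_le _) h0
  have hnb_max : ∀ n, nb < n → n ≤ na - 1 → ¬ (a + ℓ ≤ x n) := fun n h1 h2 =>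
    Nat.findGreatest_is_greatest h1 h2
  have hsub : Finset.Ioo nb na ⊆
      (Finset.range (m + 1)).filter fun n => a ≤ x n ∧ x n ≤ a + ℓ := by
    intro n hn
    rw [Finset.mem_Ioo] at hn
    rw [Finset.mem_filter, Finset.mem_range]
    exact ⟨by omega, hna_min n hn.2, le_of_lt (not_le.mp (hnb_max n hn.1 (by omega)))⟩
  have htel : ∀ k, nb + k ≤ m → x nb - x (nb + k) ≤ h * k := by
    intro k
    induction k with
    | zero => intro _; simp
    | succ k ih =>
      intro hk
      have h1 := hstep (nb + k) (by omega)
      rw [abs_le] at h1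
      have h2 := ih (by omega)
      rw [show nb + (k + 1) = nb + k + 1 by ring]
      push_cast
      linarith [h1.1]
  have hgap : ℓ < h * ((na - nb : ℕ) : ℝ) := by
    have := htel (na - nb) (by omega)
    rw [show nb + (na - nb) = na by omega] at this
    linarith
  have hcard : ((Finset.Ioo nb na).card : ℝ) = ((na - nb : ℕ) : ℝ) - 1 := by
    rw [Nat.card_Ioo, Nat.cast_sub (by omega : 1 ≤ na - nb), Nat.cast_one]
  calc ℓ / h - 1 ≤ ((na - nb : ℕ) : ℝ) - 1 := by
        rw [sub_le_sub_iff_right, div_le_iff₀ hh]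
        linarith
    _ = ((Finset.Ioo nb na).card : ℝ) := hcard.symm
    _ ≤ _ := by exact_mod_cast Finset.card_le_card hsub

/-- **Good rows.** If the shell level is inside the band, `|μ| ≤ 4 - s²` (`0 < s ≤ 1`,
`L ≥ 400/s²`), then at least `s²L/(32π)` momenta `n < L/2 + 1` have
`|2cos(2πn/L) + μ| ≤ 2 - s²/2` (rows that cross the Fermi level transversally): the antitone
sequence `cos(2πn/L)`, `0 ≤ n ≤ L/2`, has steps `≤ 2π/L` and passes through an interval of
length `s²/8` of admissible values. [folklore] -/
theorem card_cooperGoodRows_ge {L : ℕ} {s μ : ℝ} (hs : 0 < s) (hs1 : s ≤ 1) (hμ : |μ| ≤ 4 - s ^ 2)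
    (hL : 400 / s ^ 2 ≤ (L : ℝ)) :
    s ^ 2 * L / (32 * π) ≤
      (((Finset.range (L / 2 + 1)).filter fun n : ℕ =>
          |2 * Real.cos (2 * π * (n : ℝ) / L) + μ| ≤ 2 - s ^ 2 / 2).card : ℝ) := by
  have hπ := Real.pi_pos
  have hπ3 := Real.pi_gt_three
  have hs2 : 0 < s ^ 2 := by positivity
  have hsL : 400 ≤ s ^ 2 * L := by rwa [div_le_iff₀ hs2, mul_comm] at hL
  have hLr : (0 : ℝ) < L := by nlinarith
  have hL1 : (1 : ℝ) ≤ L := by nlinarith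
  have hLpos : 0 < L := by exact_mod_cast hLr
  rw [abs_le] at hμ
  -- the target interval `[a, a + s²/8]`
  set a : ℝ := max (-1 + s ^ 2 / 4 - μ / 2) (-1 + s ^ 2 / 8) with ha
  have ha1 : -1 + s ^ 2 / 4 - μ / 2 ≤ a := le_max_left _ _
  have ha2 : -1 + s ^ 2 / 8 ≤ a := le_max_right _ _
  have hs21 : s ^ 2 ≤ 1 := by nlinarith
  have ha3 : a + s ^ 2 / 8 ≤ 1 - s ^ 2 / 4 - μ / 2 := by
    rcases le_total (-1 + s ^ 2 / 4 - μ / 2) (-1 + s ^ 2 / 8) with h | h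
    · rw [ha, max_eq_right h]; linarith
    · rw [ha, max_eq_left h]; linarith
  have ha4 : a + s ^ 2 / 8 ≤ 1 := by
    rcases le_total (-1 + s ^ 2 / 4 - μ / 2) (-1 + s ^ 2 / 8) with h | h
    · rw [ha, max_eq_right h]; nlinarith
    · rw [ha, max_eq_left h]; linarith
  -- the sequence `x n = cos(2πn/L)` on `0 ≤ n ≤ m = L/2`
  set m : ℕ := L / 2 with hm
  have hstep : ∀ n < m, |Real.cos (2 * π * ((n + 1 : ℕ) : ℝ) / L) -
      Real.cos (2 * π * (n : ℝ) / L)| ≤ 2 * π / L := by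
    intro n _
    have h := Real.abs_cos_sub_cos_le (2 * π * ((n + 1 : ℕ) : ℝ) / L) (2 * π * (n : ℝ) / L)
    rwa [show 2 * π * ((n + 1 : ℕ) : ℝ) / L - 2 * π * (n : ℝ) / L = 2 * π / L by push_cast; ring,
      abs_of_pos (show (0 : ℝ) < 2 * π / L by positivity)] at h
  have hxm : Real.cos (2 * π * (m : ℝ) / L) < a := by
    -- `2πm/L = π - πr/L`, `cos = -cos(πr/L) ≤ -cos(π/L) ≤ -1 + π²/(2L²) < -1 + s²/8`
    obtain ⟨r, hr, hLmr⟩ : ∃ r : ℕ, r ≤ 1 ∧ L = 2 * m + r := ⟨L % 2, by omega, by omega⟩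
    have hangle : 2 * π * (m : ℝ) / L = π - π * r / L := by
      have : (L : ℝ) = 2 * m + r := by exact_mod_cast hLmr
      field_simp
      rw [this]
      ring
    rw [hangle, Real.cos_pi_sub]
    have h1 : Real.cos (π / L) ≤ Real.cos (π * r / L) := by
      apply Real.cos_le_cos_of_nonneg_of_le_pi (by positivity)
      · rw [div_le_iff₀ hLr]; nlinarith
      · have : (r : ℝ) ≤ 1 := by exact_mod_cast hr
        rw [div_le_div_iff_of_pos_right hLr]
        nlinarith
    have h2 := Real.one_sub_sq_div_two_le_cos (x := π / L)
    have h3 : (π / L) ^ 2 < s ^ 2 / 4 := by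
      rw [div_pow, div_lt_iff₀ (by positivity)]
      have hπ10 : π ^ 2 < 10 := by nlinarith [Real.pi_lt_d2]
      have : π ^ 2 < s ^ 2 / 4 * L := by nlinarith
      nlinarith
    linarith
  have hx0 : a + s ^ 2 / 8 ≤ Real.cos (2 * π * ((0 : ℕ) : ℝ) / L) := by
    simp only [Nat.cast_zero, mul_zero, zero_div, Real.cos_zero]
    exact ha4
  have hcount := sub_one_le_card_filter_mem_Icc (x := fun n : ℕ => Real.cos (2 * π * (n : ℝ) / L))
    (by positivity : (0 : ℝ) < 2 * π / L) (by positivity : (0 : ℝ) ≤ s ^ 2 / 8) hstep hxm hx0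
  -- the visited points are good rows
  have hsub : ((Finset.range (m + 1)).filter fun n : ℕ =>
      a ≤ Real.cos (2 * π * (n : ℝ) / L) ∧ Real.cos (2 * π * (n : ℝ) / L) ≤ a + s ^ 2 / 8) ⊆
      ((Finset.range (L / 2 + 1)).filter fun n : ℕ =>
          |2 * Real.cos (2 * π * (n : ℝ) / L) + μ| ≤ 2 - s ^ 2 / 2) := by
    intro n hn
    rw [Finset.mem_filter] at hn ⊢
    refine ⟨hn.1, ?_⟩
    rw [abs_le]
    constructor <;> linarith [hn.2.1, hn.2.2]
  have e : s ^ 2 / 8 / (2 * π / L) = s ^ 2 * L / (16 * π) := by field_simp; ring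
  calc s ^ 2 * L / (32 * π) ≤ s ^ 2 * L / (16 * π) - 1 := by
        have h32 : 1 ≤ s ^ 2 * L / (32 * π) := by
          rw [le_div_iff₀ (by positivity)]
          nlinarith [Real.pi_lt_d2]
        have e2 : s ^ 2 * L / (16 * π) = 2 * (s ^ 2 * L / (32 * π)) := by field_simp; ring
        linarith
    _ = s ^ 2 / 8 / (2 * π / L) - 1 := by rw [e]
    _ ≤ _ := hcount
    _ ≤ _ := by exact_mod_cast Finset.card_le_card hsub

end GoodRows

section Assembly

open Real

variable {L : ℕ} [NeZero L] {N : ℕ}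

/-- The Cooper sum as an indicator-weighted sum over all momenta. [folklore] -/
theorem torusCooperSum_eq_sum_ite (η : ℝ) :
    torusCooperSum L N η = ((L : ℝ) ^ 2)⁻¹ * ∑ k : TorusSite 2 L,
      (if η < |torusXi L N k| then 1 / (2 * |torusXi L N k|) else 0) := by
  rw [torusCooperSum_def, Finset.sum_filter]

omit [NeZero L] in
/-- Row decomposition of a sum over the momentum grid: `Σ_k G(k) = Σ_b Σ_a G(a, b)`. [folklore] -/
theorem sum_torusSite_two_eq [NeZero L] (G : TorusSite 2 L → ℝ) :
    ∑ k, G k = ∑ b : ZMod L, ∑ a : ZMod L, G ![a, b] := by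
  rw [← (finTwoArrowEquiv (ZMod L)).symm.sum_comp, Fintype.sum_prod_type_right]
  rfl

/-- The energy of the momentum `(a, b)` measured from the shell level, in coordinates.
[folklore] -/
theorem torusXi_vecCons (a b : ZMod L) :
    torusXi L N ![a, b] = -2 * Real.cos (2 * π * (a.val : ℝ) / L) +
      (-2 * Real.cos (2 * π * (b.val : ℝ) / L) - torusFermiLevel L N) := by
  simp only [torusXi, torusBand, latticeMomentum, Fin.sum_univ_two, Matrix.cons_val_zero,
    Matrix.cons_val_one]
  ring

/-- **One good row of the torus** carries `(L/(32π)) log L` of the (unnormalised) Cooper sum at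
buffer `1/L`. [folklore] -/
theorem torusRow_sum_ge {s : ℝ} (hs : 0 < s) (hs1 : s ≤ 1) (hL : 400 / s ^ 2 ≤ (L : ℝ))
    (hL2 : (128 / s ^ 3) ^ 2 ≤ (L : ℝ)) (b : ZMod L)
    (hb : |2 * Real.cos (2 * π * (b.val : ℝ) / L) + torusFermiLevel L N| ≤ 2 - s ^ 2 / 2) :
    (L : ℝ) / (32 * π) * Real.log L ≤
      ∑ a : ZMod L, (if 1 / (L : ℝ) < |torusXi L N ![a, b]|
        then 1 / (2 * |torusXi L N ![a, b]|) else 0) := by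
  set c : ℝ := -2 * Real.cos (2 * π * (b.val : ℝ) / L) - torusFermiLevel L N with hc
  have hc' : |c| ≤ 2 - s ^ 2 / 2 := by
    rw [hc, show -2 * Real.cos (2 * π * (b.val : ℝ) / L) - torusFermiLevel L N =
      -(2 * Real.cos (2 * π * (b.val : ℝ) / L) + torusFermiLevel L N) by ring, abs_neg]
    exact hb
  have key := cooperRow_sum_ge (L := L) (fun n : ℕ => -2 * Real.cos (2 * π * (n : ℝ) / L) + c)
    (fun n => rfl) hs hs1 hc' hL hL2
  refine key.trans (le_of_eq ?_)
  rw [Finset.sum_filter]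
  refine Finset.sum_nbij (fun n : ℕ => (n : ZMod L)) (fun n _ => Finset.mem_univ _) ?_ ?_ ?_
  · intro n hn m hm h
    have hn' : n < L := by simpa using hn
    have hm' : m < L := by simpa using hm
    have := congrArg ZMod.val h
    rwa [ZMod.val_cast_of_lt hn', ZMod.val_cast_of_lt hm'] at this
  · intro a _
    exact ⟨a.val, by simpa using ZMod.val_lt a, ZMod.natCast_zmod_val a⟩
  · intro n hn
    have hn' : n < L := by simpa using hn
    simp only [torusXi_vecCons, ZMod.val_cast_of_lt hn', hc]

/-- **The Cooper logarithm on the torus, quantitative form.** If `θL² ≤ N ≤ (2 - θ)L²` and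
`L ≥ 6400/θ²`, `L ≥ (8192/θ³)²`, then
`torusCooperSum L N (1/L) ≥ θ²/(16384π²) · log L`. Proof: the shell level stays inside
`[-4 + θ²/16, 4 - θ²/16]` (`torusFermiLevel_mem_Icc`); at least `θ²L/(512π)` rows cross it
transversally (`card_cooperGoodRows_ge`), and each contributes `(L/(32π)) log L`
(`torusRow_sum_ge`). [folklore] -/
theorem torusCooperSum_inv_ge {θ : ℝ} (hθ : 0 < θ) (hN1 : θ * (L : ℝ) ^ 2 ≤ N)
    (hN2 : (N : ℝ) ≤ (2 - θ) * (L : ℝ) ^ 2) (hL : 6400 / θ ^ 2 ≤ (L : ℝ))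
    (hL2 : (8192 / θ ^ 3) ^ 2 ≤ (L : ℝ)) :
    θ ^ 2 / (16384 * π ^ 2) * Real.log L ≤ torusCooperSum L N (1 / L) := by
  have hπ := Real.pi_pos
  have hLr : (0 : ℝ) < L := by exact_mod_cast Nat.pos_of_ne_zero (NeZero.ne L)
  have hθ1 : θ ≤ 1 := by
    have h := le_of_mul_le_mul_right (hN1.trans hN2) (by positivity : (0 : ℝ) < (L : ℝ) ^ 2)
    linarith
  -- the small parameter `s = θ/4`
  set s : ℝ := θ / 4 with hsdef
  have hs : 0 < s := by positivity
  have hs1 : s ≤ 1 := by rw [hsdef]; linarith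
  have hs2 : s ^ 2 = θ ^ 2 / 16 := by rw [hsdef]; ring
  have hLs : 400 / s ^ 2 ≤ (L : ℝ) := by
    rw [hs2, show (400 : ℝ) / (θ ^ 2 / 16) = 6400 / θ ^ 2 by field_simp; ring]; exact hL
  have hLs2 : (128 / s ^ 3) ^ 2 ≤ (L : ℝ) := by
    rw [hsdef, show (128 : ℝ) / (θ / 4) ^ 3 = 8192 / θ ^ 3 by field_simp; ring]; exact hL2
  have hsL : 400 ≤ s ^ 2 * L := by
    rwa [div_le_iff₀ (by positivity), mul_comm] at hLs
  have hL1 : (1 : ℝ) ≤ L := by nlinarith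
  have hlog : 0 ≤ Real.log L := Real.log_nonneg hL1
  -- the shell level is inside the band
  have hθL : 18 ≤ θ * (L : ℝ) ^ 2 := by
    have h1 : θ ^ 2 * L ≥ 6400 := by
      have := hL; rw [div_le_iff₀ (by positivity)] at this; linarith
    nlinarith
  obtain ⟨hμ1, hμ2⟩ := torusFermiLevel_mem_Icc (L := L) hθ hθL hN1 hN2
  have hμ : |torusFermiLevel L N| ≤ 4 - s ^ 2 := by
    rw [hs2, abs_le]; constructor <;> linarith
  -- the good rows
  set G : Finset ℕ := (Finset.range (L / 2 + 1)).filter fun n : ℕ =>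
    |2 * Real.cos (2 * π * (n : ℝ) / L) + torusFermiLevel L N| ≤ 2 - s ^ 2 / 2 with hG
  have hGcard : s ^ 2 * L / (32 * π) ≤ (G.card : ℝ) := card_cooperGoodRows_ge hs hs1 hμ hLs
  have hGlt : ∀ n ∈ G, n < L := by
    intro n hn
    rw [hG, Finset.mem_filter, Finset.mem_range] at hn
    have := Nat.pos_of_ne_zero (NeZero.ne L)
    omega
  set GB : Finset (ZMod L) := G.image fun n : ℕ => (n : ZMod L) with hGB
  have hinj : Set.InjOn (fun n : ℕ => (n : ZMod L)) ↑G := by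
    intro n hn m hm h
    have := congrArg ZMod.val h
    rwa [ZMod.val_cast_of_lt (hGlt n hn), ZMod.val_cast_of_lt (hGlt m hm)] at this
  have hGBcard : (GB.card : ℝ) = G.card := by
    rw [hGB, Finset.card_image_of_injOn hinj]
  -- the momentum-space function
  set F : TorusSite 2 L → ℝ := fun k =>
    if 1 / (L : ℝ) < |torusXi L N k| then 1 / (2 * |torusXi L N k|) else 0 with hF
  have hFnn : ∀ k, 0 ≤ F k := fun k => by
    simp only [hF]
    split_ifs <;> positivity
  have hrow : ∀ b ∈ GB, (L : ℝ) / (32 * π) * Real.log L ≤ ∑ a : ZMod L, F ![a, b] := by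
    intro b hb
    rw [hGB, Finset.mem_image] at hb
    obtain ⟨n, hn, rfl⟩ := hb
    apply torusRow_sum_ge hs hs1 hLs hLs2
    rw [ZMod.val_cast_of_lt (hGlt n hn)]
    exact (Finset.mem_filter.mp hn).2
  -- the chain
  have htotal : s ^ 2 * L / (32 * π) * ((L : ℝ) / (32 * π) * Real.log L) ≤ ∑ k, F k := by
    calc s ^ 2 * L / (32 * π) * ((L : ℝ) / (32 * π) * Real.log L)
        ≤ (GB.card : ℝ) * ((L : ℝ) / (32 * π) * Real.log L) := by
          rw [hGBcard]; gcongr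
      _ = ∑ b ∈ GB, (L : ℝ) / (32 * π) * Real.log L := by rw [Finset.sum_const, nsmul_eq_mul]
      _ ≤ ∑ b ∈ GB, ∑ a : ZMod L, F ![a, b] := Finset.sum_le_sum hrow
      _ ≤ ∑ b : ZMod L, ∑ a : ZMod L, F ![a, b] :=
          Finset.sum_le_sum_of_subset_of_nonneg (Finset.subset_univ _) fun b _ _ =>
            Finset.sum_nonneg fun a _ => hFnn _
      _ = ∑ k, F k := (sum_torusSite_two_eq F).symm
  rw [torusCooperSum_eq_sum_ite]
  calc θ ^ 2 / (16384 * π ^ 2) * Real.log L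
      = ((L : ℝ) ^ 2)⁻¹ * (s ^ 2 * L / (32 * π) * ((L : ℝ) / (32 * π) * Real.log L)) := by
        rw [hs2]; field_simp; ring
    _ ≤ ((L : ℝ) ^ 2)⁻¹ * ∑ k, F k := by gcongr

end Assembly

section Headline

open Real

/-- **The Cooper logarithm on the torus.** For fillings bounded away from the empty and the
full band, `θL² ≤ N ≤ (2 - θ)L²` (`θ > 0`), the torus Cooper sum at any buffer `η ≤ 1/L`
(in particular `η = 1/L` and `η = 0`) grows at least logarithmically in the side:
`torusCooperSum L N η ≥ c(θ) log L` for `L ≥ L₀(θ)` (here `c = θ²/(16384π²)`; for `η ≤ 1/L` by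
antitonicity from `η = 1/L`). This is the finite-volume, zero-temperature counterpart of the
`½N(0) log β` divergence of Salmhofer's bubble (`Literature.Barriers.HubbardSuperconductivity.
WeakCouplingCeiling_holds`), with the level spacing `∼ 1/L` in place of the temperature; only
the lower bound is asserted. [folklore] -/
theorem exists_log_le_torusCooperSum {θ : ℝ} (hθ : 0 < θ) :
    ∃ c : ℝ, 0 < c ∧ ∃ L₀ : ℕ, ∀ (L : ℕ) [NeZero L] (N : ℕ), L₀ ≤ L →
      θ * (L : ℝ) ^ 2 ≤ N → (N : ℝ) ≤ (2 - θ) * (L : ℝ) ^ 2 →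
        ∀ η : ℝ, η ≤ 1 / L → c * Real.log L ≤ torusCooperSum L N η := by
  refine ⟨θ ^ 2 / (16384 * π ^ 2), by positivity,
    ⌈max (6400 / θ ^ 2) ((8192 / θ ^ 3) ^ 2)⌉₊, ?_⟩
  intro L _ N hL hN1 hN2 η hη
  have hL' : max (6400 / θ ^ 2) ((8192 / θ ^ 3) ^ 2) ≤ (L : ℝ) := Nat.ceil_le.mp hL
  exact (torusCooperSum_inv_ge hθ hN1 hN2 ((le_max_left _ _).trans hL')
    ((le_max_right _ _).trans hL')).trans (torusCooperSum_antitone hη)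

/-- **The Cooper logarithm on the torus at hole doping `δ ∈ [0, 1)`**: with
`N_L = 2⌊(1 - δ)L²/2⌋` electrons (the canonical sector of the summit `HubbardSuperconductivity`),
`torusCooperSum L N_L η ≥ c(δ) log L` for all `L ≥ L₀(δ)` and every buffer `η ≤ 1/L`.
[folklore] -/
theorem exists_log_le_torusCooperSum_doping {δ : ℝ} (hδ0 : 0 ≤ δ) (hδ1 : δ < 1) :
    ∃ c : ℝ, 0 < c ∧ ∃ L₀ : ℕ, ∀ (L : ℕ) [NeZero L], L₀ ≤ L → ∀ η : ℝ, η ≤ 1 / L →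
      c * Real.log L ≤ torusCooperSum L (2 * ⌊(1 - δ) * (L : ℝ) ^ 2 / 2⌋₊) η := by
  obtain ⟨c, hc, L₀, h⟩ := exists_log_le_torusCooperSum (θ := (1 - δ) / 2) (by linarith)
  refine ⟨c, hc, max L₀ ⌈4 / (1 - δ)⌉₊, fun L _ hL η hη => ?_⟩
  have hδ : 0 < 1 - δ := by linarith
  have hL0 : L₀ ≤ L := (le_max_left _ _).trans hL
  have hL4 : 4 / (1 - δ) ≤ (L : ℝ) := Nat.ceil_le.mp ((le_max_right _ _).trans hL)
  have hL1 : (1 : ℝ) ≤ L := by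
    have : (4 : ℝ) ≤ 4 / (1 - δ) := by rw [le_div_iff₀ hδ]; nlinarith
    linarith
  have hLsq : 4 / (1 - δ) ≤ (L : ℝ) ^ 2 := hL4.trans (by nlinarith)
  set x : ℝ := (1 - δ) * (L : ℝ) ^ 2 / 2 with hx
  have hx0 : 0 ≤ x := by positivity
  have hfl1 : (⌊x⌋₊ : ℝ) ≤ x := Nat.floor_le hx0
  have hfl2 : x < ⌊x⌋₊ + 1 := Nat.lt_floor_add_one x
  have hx4 : 2 ≤ x := by
    rw [hx, le_div_iff₀ two_pos]
    rw [div_le_iff₀ hδ] at hLsq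
    linarith
  refine h L _ hL0 ?_ ?_ η hη
  · push_cast
    linarith
  · push_cast
    nlinarith

end Headline

end Literature.MathematicalPhysics.QuantumLattice
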